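import Summits.HodgeConjecture.HodgeConjecture.Theorems.F0P3cStCharTSCartanNullDischarge   -- ★ p851428 (F0P3-p04): `ae_isRegularElt_centralizer_Gqs`, `isUnit_qsForm` (G-side Cartan null set)
import Summits.HodgeConjecture.HodgeConjecture.Theorems.F0P3cStCharTSUpTrExchange          -- ★ p852501 ((A1′)-D, LH10-p01): `isLocalGRegular_iff_isRegularElt_of_isLocalNormPair`
import Literature.NumberTheory.Rogawski1990.LocalEndoscopicTorusTransport                  -- ★ (Θ): `exists_localEndoCentralizerEquiv_normPair` (`Z_H(γ₀) ≃ₜ* Z_G(γ)` along `ι_v`)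
import Literature.NumberTheory.Automorphic.HaarNormalizedIntegralTransport                 -- ★ `ae_comp_continuousMulEquiv_of_ae` (a.e. statements along `≃ₜ*`, any two Haar measures)
import HarnessLib

/-!
# F0 · P3c · line LH6 «StCharTS» — road «M5-H» (census `F0/P3a/F0P3a-p04/g29/m5h/CENSUS-M5H.v1`), brick (B4) «ELL-MASS-H NULL»:
# Haar-almost every element of a Cartan subgroup `Z_H(γ₀)` of `H_v = U(Φ₂)(L⁺_v) × U(Φ₁)(L⁺_v)` (`γ₀` `G`-regular, `v` non-split) is `G`-regular
# [HarishChandra1970, Lemma 42; Rogawski1990, §3.6, §4.3 p. 42, §12.5 p. 184]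

Cell `pub/hodgecm-mathlib`, crux H413 = `stmt-HodgeConjecture-24833` (lane `--supports … --as helper`), route HCCMUnconditional; seat F0P3a-p04 (g29); desk word
F0P3-plan (g18) 2026-09-02T19:46:53Z (census «M5-H»).  THEOREMS ONLY (no definition ∕ instance ∕ notation ∕ named fact ∕ `sorry`); ★-only imports.

WHY.  The block consequent (M5) `Ch12Sec5.EllipticData.PacketCharHNorm` of RUNG 0 v8 (★ `F0P3cStCharTSRung0Eight` :212) integrates `D_H² · χ_ρ · conj χ_ρ` over the WHOLE of
each compact Cartan representative `T ∈ SH` (`Ch12Sec5Defs.innerH`), while everything the tree knows about `χ_{St_H}` (★ ELL-VALUE-H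
`F0P3cStCharTSStStableEll.charSt_eq_neg_xiLocalChar_of_not_mem_hyperbolicSet`) and about the Weyl integration formula on `H_v` (★ (H5″)
`F0P3cStCharTSUpTrWIFHClosed.integral_mul_classFun_eq_finsetSum_DH_classOrbitalIntegral_H_of_splitSocket`) lives on the `G`-REGULAR part `T^{G-reg}`.  This file supplies
the bridge: `T ∖ T^{G-reg}` is null for every Haar measure on `T`, so `∫_{T^{G-reg}} = ∫_T` and a.e.-statements on `T^{G-reg}` are a.e.-statements on `T`.

THE MATHEMATICS.  `T = Z_H(γ₀)` with `γ₀` `G`-regular.  ★ (Θ) `exists_localEndoCentralizerEquiv_normPair` (at the trivial norm pair `γ₀ ↔ ι_v(γ₀)`) gives an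
isomorphism of topological groups `e : Z_H(γ₀) ≃ₜ* Z_G(ι_v γ₀)` onto a Cartan subgroup of `G = U(Φ₃)(L⁺_v)` along which every `z` is a norm pair with `e z`; a norm pair
is `G`-regular on the `H` side iff regular on the `G` side (★ `isLocalGRegular_iff_isRegularElt_of_isLocalNormPair`); on `Z_G(ι_v γ₀)` Haar-almost every element is
regular (★ «CARTAN-NULL★» `ae_isRegularElt_centralizer_Gqs`: the singular set lies in finitely many closed non-open subgroups [HarishChandra1970, Lemma 42]); and
a.e.-statements travel along `e` for ANY pair of Haar measures (★ `ae_comp_continuousMulEquiv_of_ae`: `e_*μ` is a positive multiple of any Haar measure).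

* §1 `ae_isLocalGRegular_centralizerH` — `∀ᵐ t ∂μT, IsLocalGRegular L v ↑t` for ANY Haar measure `μT` on `Z_H(γ₀)`; `measure_setOf_not_isLocalGRegular_centralizerH_eq_zero`;
  the `(T, hT : T = Z_H(γ₀))` dresses `ae_isLocalGRegular_of_eq_centralizerH` ∕ `measure_setOf_not_isLocalGRegular_of_eq_centralizerH_eq_zero` (the shape of the RUNG 0 binder
  `hKHO : ∀ T ∈ SH, IsCompact T ∧ ∃ γ₀, IsLocalGRegular L v γ₀ ∧ T = Z_H(γ₀)`, ★ `F0P3cStCharTSRung0Eight` :143).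
* §2 `restrict_setOf_isLocalGRegular_eq_self`, `setIntegral_setOf_isLocalGRegular_eq_integral` — `μT|_{T^{G-reg}} = μT`, hence `∫_{t ∈ T^{G-reg}} f = ∫_T f` for every `f`
  (the set integrals of ★ (H5″) ∕ ★ SWIFH ∕ ★ (A0-H) read as integrals over `T`).
HONEST LABEL: count-neutral helper of the «M5-H» road; (M5) stays a PRINT block consequent until the road's bricks are ★ and a desk-priced edition consumes them; HC_CM is
proved only modulo the 7 printed citations (2 remaining named inputs: hLiu418 = `stmt-HodgeConjecture-24832`, h413 = `stmt-HodgeConjecture-24833`) until rung 0 closes.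

## References
* [HarishChandra1970] Harish-Chandra (notes by G. van Dijk), *Harmonic Analysis on Reductive p-adic Groups*, LNM 162 (1970), Lemma 42.
* [Rogawski1990] J. D. Rogawski, *Automorphic Representations of Unitary Groups in Three Variables*, Ann. of Math. Stud. 123 (1990): §3.6 pp. 28–31; §4.3 p. 42;
  §12.5 pp. 182–184.
* [DeitmarEchterhoff2014] A. Deitmar, S. Echterhoff, *Principles of Harmonic Analysis*, 2nd ed. (2014), Thm. 1.5.3.
-/

set_option autoImplicit false
-- the mandated namespace has the single-problem summit's repeated segment (`HodgeConjecture.HodgeConjecture`)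
set_option linter.dupNamespace false

noncomputable section

open NumberField IsDedekindDomain MeasureTheory Measure Filter Topology
open scoped Matrix MatrixGroups ENNReal
open Literature.NumberTheory.Rogawski1990 Literature.NumberTheory.Automorphic Literature.NumberTheory.Automorphic.UnitaryGroup

namespace Summit.HodgeConjecture.HodgeConjecture.Cruxes.H413.F0P3cStCharTSEllMassHNull

section CM

variable (L : Type) [Field L] [NumberField L] [IsCMField L] (v : HeightOneSpectrum (𝓞 ↥(maximalRealSubfield L)))

/-! ## §1 Haar-almost every element of `Z_H(γ₀)` is `G`-regular -/

/-- **Haar-almost every element of the Cartan subgroup `Z_H(γ₀) ≤ H_v` is `G`-regular** (`γ₀` `G`-regular, `v` non-split, `μT` ANY Haar measure on `Z_H(γ₀)`; no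
compactness needed).  Transport of ★ `ae_isRegularElt_centralizer_Gqs` along ★ (Θ) `e : Z_H(γ₀) ≃ₜ* Z_G(ι_v γ₀)` (norm pairs pointwise, ★
`isLocalGRegular_iff_isRegularElt_of_isLocalNormPair`) by ★ `ae_comp_continuousMulEquiv_of_ae`.
[cite: HarishChandra1970, Lemma 42] [cite: Rogawski1990, §4.3 p. 42; §12.5 p. 184] [cite: DeitmarEchterhoff2014, Thm. 1.5.3] -/
theorem ae_isLocalGRegular_centralizerH (hns : ∀ w : PlacesOver L v, IsCMField.complexConj L • w.1 = w.1)
    [MeasurableSpace ((UnitaryGroup.cmDatum L 2 (Matrix.of fun i j : Fin 2 => if i.val + j.val + 1 = 2 then (1 : L) else 0)).Local v ×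
      (UnitaryGroup.cmDatum L 1 (Matrix.of fun i j : Fin 1 => if i.val + j.val + 1 = 1 then (1 : L) else 0)).Local v)]
    [BorelSpace ((UnitaryGroup.cmDatum L 2 (Matrix.of fun i j : Fin 2 => if i.val + j.val + 1 = 2 then (1 : L) else 0)).Local v ×
      (UnitaryGroup.cmDatum L 1 (Matrix.of fun i j : Fin 1 => if i.val + j.val + 1 = 1 then (1 : L) else 0)).Local v)]
    {γ₀ : (UnitaryGroup.cmDatum L 2 (Matrix.of fun i j : Fin 2 => if i.val + j.val + 1 = 2 then (1 : L) else 0)).Local v ×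
      (UnitaryGroup.cmDatum L 1 (Matrix.of fun i j : Fin 1 => if i.val + j.val + 1 = 1 then (1 : L) else 0)).Local v}
    (hγ₀ : IsLocalGRegular L v γ₀)
    (μT : Measure ↥(Subgroup.centralizer ({γ₀} : Set ((UnitaryGroup.cmDatum L 2 (Matrix.of fun i j : Fin 2 => if i.val + j.val + 1 = 2 then (1 : L) else 0)).Local v ×
      (UnitaryGroup.cmDatum L 1 (Matrix.of fun i j : Fin 1 => if i.val + j.val + 1 = 1 then (1 : L) else 0)).Local v)))) [μT.IsHaarMeasure] :
    ∀ᵐ t : ↥(Subgroup.centralizer ({γ₀} : Set ((UnitaryGroup.cmDatum L 2 (Matrix.of fun i j : Fin 2 => if i.val + j.val + 1 = 2 then (1 : L) else 0)).Local v ×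
      (UnitaryGroup.cmDatum L 1 (Matrix.of fun i j : Fin 1 => if i.val + j.val + 1 = 1 then (1 : L) else 0)).Local v))) ∂μT,
      IsLocalGRegular L v (t : (UnitaryGroup.cmDatum L 2 (Matrix.of fun i j : Fin 2 => if i.val + j.val + 1 = 2 then (1 : L) else 0)).Local v ×
      (UnitaryGroup.cmDatum L 1 (Matrix.of fun i j : Fin 1 => if i.val + j.val + 1 = 1 then (1 : L) else 0)).Local v) := by
  obtain ⟨w⟩ : Nonempty (PlacesOver L v) := inferInstance
  have hw : IsCMField.complexConj L • w.1 = w.1 := hns w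
  letI : MeasurableSpace (Gqs L v) := borel _
  haveI : BorelSpace (Gqs L v) := ⟨rfl⟩
  -- the trivial norm pair `γ₀ ↔ ι_v(γ₀)`
  have hm : IsLocalNormPair L (qsForm L) v γ₀ (endoEmbLocal L v γ₀) := IsConj.refl _
  obtain ⟨e, -, hpair, -⟩ := exists_localEndoCentralizerEquiv_normPair L v (UnitaryGroup.isUnit_antidiagOne_det L 3).ne_zero hγ₀ hm
  have hγ₀' : IsRegularElt (((endoEmbLocal L v γ₀) : Gqs L v).val : GL (Fin 3) (UnitaryGroup.LocalRing L v)) :=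
    (F0P3cStCharTSUpTrExchange.isLocalGRegular_iff_isRegularElt_of_isLocalNormPair L v hm).1 hγ₀
  -- the `G`-side Cartan is locally compact (closed in `G`)
  haveI : LocallyCompactSpace ↥(Subgroup.centralizer ({endoEmbLocal L v γ₀} : Set (Gqs L v))) :=
    (isClosed_coe_centralizer_singleton (endoEmbLocal L v γ₀)).isClosedEmbedding_subtypeVal.locallyCompactSpace
  haveI : (μT.map e).IsHaarMeasure := e.isHaarMeasure_map μT
  have hB := F0P3cStCharTSCartanNullDischarge.ae_isRegularElt_centralizer_Gqs L v w hw (endoEmbLocal L v γ₀) hγ₀' (μT.map e)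
  have hA := ae_comp_continuousMulEquiv_of_ae e μT (μT.map e) hB
  exact hA.mono fun t ht => (F0P3cStCharTSUpTrExchange.isLocalGRegular_iff_isRegularElt_of_isLocalNormPair L v (hpair t)).2 ht

/-- **The non-`G`-regular part of `Z_H(γ₀)` is Haar-null**: `μT {t | ¬ IsLocalGRegular L v ↑t} = 0`. [cite: HarishChandra1970, Lemma 42] [cite: Rogawski1990, §12.5 p. 184] -/
theorem measure_setOf_not_isLocalGRegular_centralizerH_eq_zero (hns : ∀ w : PlacesOver L v, IsCMField.complexConj L • w.1 = w.1)
    [MeasurableSpace ((UnitaryGroup.cmDatum L 2 (Matrix.of fun i j : Fin 2 => if i.val + j.val + 1 = 2 then (1 : L) else 0)).Local v ×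
      (UnitaryGroup.cmDatum L 1 (Matrix.of fun i j : Fin 1 => if i.val + j.val + 1 = 1 then (1 : L) else 0)).Local v)]
    [BorelSpace ((UnitaryGroup.cmDatum L 2 (Matrix.of fun i j : Fin 2 => if i.val + j.val + 1 = 2 then (1 : L) else 0)).Local v ×
      (UnitaryGroup.cmDatum L 1 (Matrix.of fun i j : Fin 1 => if i.val + j.val + 1 = 1 then (1 : L) else 0)).Local v)]
    {γ₀ : (UnitaryGroup.cmDatum L 2 (Matrix.of fun i j : Fin 2 => if i.val + j.val + 1 = 2 then (1 : L) else 0)).Local v ×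
      (UnitaryGroup.cmDatum L 1 (Matrix.of fun i j : Fin 1 => if i.val + j.val + 1 = 1 then (1 : L) else 0)).Local v}
    (hγ₀ : IsLocalGRegular L v γ₀)
    (μT : Measure ↥(Subgroup.centralizer ({γ₀} : Set ((UnitaryGroup.cmDatum L 2 (Matrix.of fun i j : Fin 2 => if i.val + j.val + 1 = 2 then (1 : L) else 0)).Local v ×
      (UnitaryGroup.cmDatum L 1 (Matrix.of fun i j : Fin 1 => if i.val + j.val + 1 = 1 then (1 : L) else 0)).Local v)))) [μT.IsHaarMeasure] :
    μT {t : ↥(Subgroup.centralizer ({γ₀} : Set ((UnitaryGroup.cmDatum L 2 (Matrix.of fun i j : Fin 2 => if i.val + j.val + 1 = 2 then (1 : L) else 0)).Local v ×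
      (UnitaryGroup.cmDatum L 1 (Matrix.of fun i j : Fin 1 => if i.val + j.val + 1 = 1 then (1 : L) else 0)).Local v))) |
        ¬ IsLocalGRegular L v (t : (UnitaryGroup.cmDatum L 2 (Matrix.of fun i j : Fin 2 => if i.val + j.val + 1 = 2 then (1 : L) else 0)).Local v ×
      (UnitaryGroup.cmDatum L 1 (Matrix.of fun i j : Fin 1 => if i.val + j.val + 1 = 1 then (1 : L) else 0)).Local v)} = 0 :=
  ae_iff.1 (ae_isLocalGRegular_centralizerH L v hns hγ₀ μT)

/-- **A.e. `G`-regularity on a Cartan representative given as `T = Z_H(γ₀)`** — the shape of the RUNG 0 binder `hKHO` (★ `F0P3cStCharTSRung0Eight` :143: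
`∀ T ∈ SH, IsCompact T ∧ ∃ γ₀, IsLocalGRegular L v γ₀ ∧ T = Z_H(γ₀)`), for ANY Haar measure on `T`. [cite: HarishChandra1970, Lemma 42] [cite: Rogawski1990, §12.5 p. 184] -/
theorem ae_isLocalGRegular_of_eq_centralizerH (hns : ∀ w : PlacesOver L v, IsCMField.complexConj L • w.1 = w.1)
    [MeasurableSpace ((UnitaryGroup.cmDatum L 2 (Matrix.of fun i j : Fin 2 => if i.val + j.val + 1 = 2 then (1 : L) else 0)).Local v ×
      (UnitaryGroup.cmDatum L 1 (Matrix.of fun i j : Fin 1 => if i.val + j.val + 1 = 1 then (1 : L) else 0)).Local v)]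
    [BorelSpace ((UnitaryGroup.cmDatum L 2 (Matrix.of fun i j : Fin 2 => if i.val + j.val + 1 = 2 then (1 : L) else 0)).Local v ×
      (UnitaryGroup.cmDatum L 1 (Matrix.of fun i j : Fin 1 => if i.val + j.val + 1 = 1 then (1 : L) else 0)).Local v)]
    {T : Subgroup ((UnitaryGroup.cmDatum L 2 (Matrix.of fun i j : Fin 2 => if i.val + j.val + 1 = 2 then (1 : L) else 0)).Local v ×
      (UnitaryGroup.cmDatum L 1 (Matrix.of fun i j : Fin 1 => if i.val + j.val + 1 = 1 then (1 : L) else 0)).Local v)}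
    {γ₀ : (UnitaryGroup.cmDatum L 2 (Matrix.of fun i j : Fin 2 => if i.val + j.val + 1 = 2 then (1 : L) else 0)).Local v ×
      (UnitaryGroup.cmDatum L 1 (Matrix.of fun i j : Fin 1 => if i.val + j.val + 1 = 1 then (1 : L) else 0)).Local v}
    (hγ₀ : IsLocalGRegular L v γ₀)
    (hT : T = Subgroup.centralizer ({γ₀} : Set ((UnitaryGroup.cmDatum L 2 (Matrix.of fun i j : Fin 2 => if i.val + j.val + 1 = 2 then (1 : L) else 0)).Local v ×
      (UnitaryGroup.cmDatum L 1 (Matrix.of fun i j : Fin 1 => if i.val + j.val + 1 = 1 then (1 : L) else 0)).Local v)))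
    (μT : Measure ↥T) [μT.IsHaarMeasure] :
    ∀ᵐ t : ↥T ∂μT, IsLocalGRegular L v (t : (UnitaryGroup.cmDatum L 2 (Matrix.of fun i j : Fin 2 => if i.val + j.val + 1 = 2 then (1 : L) else 0)).Local v ×
      (UnitaryGroup.cmDatum L 1 (Matrix.of fun i j : Fin 1 => if i.val + j.val + 1 = 1 then (1 : L) else 0)).Local v) := by
  subst hT
  exact ae_isLocalGRegular_centralizerH L v hns hγ₀ μT

/-- **Null-set form on `T = Z_H(γ₀)`**: `μT {t | ¬ IsLocalGRegular L v ↑t} = 0` for any Haar measure `μT` on `T`. [cite: HarishChandra1970, Lemma 42] [cite: Rogawski1990, §12.5 p. 184] -/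
theorem measure_setOf_not_isLocalGRegular_of_eq_centralizerH_eq_zero (hns : ∀ w : PlacesOver L v, IsCMField.complexConj L • w.1 = w.1)
    [MeasurableSpace ((UnitaryGroup.cmDatum L 2 (Matrix.of fun i j : Fin 2 => if i.val + j.val + 1 = 2 then (1 : L) else 0)).Local v ×
      (UnitaryGroup.cmDatum L 1 (Matrix.of fun i j : Fin 1 => if i.val + j.val + 1 = 1 then (1 : L) else 0)).Local v)]
    [BorelSpace ((UnitaryGroup.cmDatum L 2 (Matrix.of fun i j : Fin 2 => if i.val + j.val + 1 = 2 then (1 : L) else 0)).Local v ×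
      (UnitaryGroup.cmDatum L 1 (Matrix.of fun i j : Fin 1 => if i.val + j.val + 1 = 1 then (1 : L) else 0)).Local v)]
    {T : Subgroup ((UnitaryGroup.cmDatum L 2 (Matrix.of fun i j : Fin 2 => if i.val + j.val + 1 = 2 then (1 : L) else 0)).Local v ×
      (UnitaryGroup.cmDatum L 1 (Matrix.of fun i j : Fin 1 => if i.val + j.val + 1 = 1 then (1 : L) else 0)).Local v)}
    {γ₀ : (UnitaryGroup.cmDatum L 2 (Matrix.of fun i j : Fin 2 => if i.val + j.val + 1 = 2 then (1 : L) else 0)).Local v ×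
      (UnitaryGroup.cmDatum L 1 (Matrix.of fun i j : Fin 1 => if i.val + j.val + 1 = 1 then (1 : L) else 0)).Local v}
    (hγ₀ : IsLocalGRegular L v γ₀)
    (hT : T = Subgroup.centralizer ({γ₀} : Set ((UnitaryGroup.cmDatum L 2 (Matrix.of fun i j : Fin 2 => if i.val + j.val + 1 = 2 then (1 : L) else 0)).Local v ×
      (UnitaryGroup.cmDatum L 1 (Matrix.of fun i j : Fin 1 => if i.val + j.val + 1 = 1 then (1 : L) else 0)).Local v)))
    (μT : Measure ↥T) [μT.IsHaarMeasure] :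
    μT {t : ↥T | ¬ IsLocalGRegular L v (t : (UnitaryGroup.cmDatum L 2 (Matrix.of fun i j : Fin 2 => if i.val + j.val + 1 = 2 then (1 : L) else 0)).Local v ×
      (UnitaryGroup.cmDatum L 1 (Matrix.of fun i j : Fin 1 => if i.val + j.val + 1 = 1 then (1 : L) else 0)).Local v)} = 0 :=
  ae_iff.1 (ae_isLocalGRegular_of_eq_centralizerH L v hns hγ₀ hT μT)

/-! ## §2 Set integrals over the `G`-regular part are integrals over the whole Cartan -/

/-- **`μT` restricted to the `G`-regular part of `T = Z_H(γ₀)` is `μT`.** [cite: HarishChandra1970, Lemma 42] [cite: Rogawski1990, §12.5 p. 184] -/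
theorem restrict_setOf_isLocalGRegular_eq_self (hns : ∀ w : PlacesOver L v, IsCMField.complexConj L • w.1 = w.1)
    [MeasurableSpace ((UnitaryGroup.cmDatum L 2 (Matrix.of fun i j : Fin 2 => if i.val + j.val + 1 = 2 then (1 : L) else 0)).Local v ×
      (UnitaryGroup.cmDatum L 1 (Matrix.of fun i j : Fin 1 => if i.val + j.val + 1 = 1 then (1 : L) else 0)).Local v)]
    [BorelSpace ((UnitaryGroup.cmDatum L 2 (Matrix.of fun i j : Fin 2 => if i.val + j.val + 1 = 2 then (1 : L) else 0)).Local v ×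
      (UnitaryGroup.cmDatum L 1 (Matrix.of fun i j : Fin 1 => if i.val + j.val + 1 = 1 then (1 : L) else 0)).Local v)]
    {T : Subgroup ((UnitaryGroup.cmDatum L 2 (Matrix.of fun i j : Fin 2 => if i.val + j.val + 1 = 2 then (1 : L) else 0)).Local v ×
      (UnitaryGroup.cmDatum L 1 (Matrix.of fun i j : Fin 1 => if i.val + j.val + 1 = 1 then (1 : L) else 0)).Local v)}
    {γ₀ : (UnitaryGroup.cmDatum L 2 (Matrix.of fun i j : Fin 2 => if i.val + j.val + 1 = 2 then (1 : L) else 0)).Local v ×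
      (UnitaryGroup.cmDatum L 1 (Matrix.of fun i j : Fin 1 => if i.val + j.val + 1 = 1 then (1 : L) else 0)).Local v}
    (hγ₀ : IsLocalGRegular L v γ₀)
    (hT : T = Subgroup.centralizer ({γ₀} : Set ((UnitaryGroup.cmDatum L 2 (Matrix.of fun i j : Fin 2 => if i.val + j.val + 1 = 2 then (1 : L) else 0)).Local v ×
      (UnitaryGroup.cmDatum L 1 (Matrix.of fun i j : Fin 1 => if i.val + j.val + 1 = 1 then (1 : L) else 0)).Local v)))
    (μT : Measure ↥T) [μT.IsHaarMeasure] :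
    μT.restrict {t : ↥T | IsLocalGRegular L v (t : (UnitaryGroup.cmDatum L 2 (Matrix.of fun i j : Fin 2 => if i.val + j.val + 1 = 2 then (1 : L) else 0)).Local v ×
      (UnitaryGroup.cmDatum L 1 (Matrix.of fun i j : Fin 1 => if i.val + j.val + 1 = 1 then (1 : L) else 0)).Local v)} = μT :=
  Measure.restrict_eq_self_of_ae_mem (ae_isLocalGRegular_of_eq_centralizerH L v hns hγ₀ hT μT)

/-- **`∫_{t ∈ T^{G-reg}} f dμT = ∫_T f dμT`** on `T = Z_H(γ₀)` (`γ₀` `G`-regular, `v` non-split), for every integrand `f` with values in a real Banach space and ANY Haar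
measure `μT` on `T` — the set integrals of ★ (H5″) ∕ ★ SWIFH ∕ ★ (A0-H) are integrals over the Cartan representative. [cite: HarishChandra1970, Lemma 42] [cite: Rogawski1990, §12.5 pp. 182–184] -/
theorem setIntegral_setOf_isLocalGRegular_eq_integral (hns : ∀ w : PlacesOver L v, IsCMField.complexConj L • w.1 = w.1)
    [MeasurableSpace ((UnitaryGroup.cmDatum L 2 (Matrix.of fun i j : Fin 2 => if i.val + j.val + 1 = 2 then (1 : L) else 0)).Local v ×
      (UnitaryGroup.cmDatum L 1 (Matrix.of fun i j : Fin 1 => if i.val + j.val + 1 = 1 then (1 : L) else 0)).Local v)]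
    [BorelSpace ((UnitaryGroup.cmDatum L 2 (Matrix.of fun i j : Fin 2 => if i.val + j.val + 1 = 2 then (1 : L) else 0)).Local v ×
      (UnitaryGroup.cmDatum L 1 (Matrix.of fun i j : Fin 1 => if i.val + j.val + 1 = 1 then (1 : L) else 0)).Local v)]
    {E : Type*} [NormedAddCommGroup E] [NormedSpace ℝ E]
    {T : Subgroup ((UnitaryGroup.cmDatum L 2 (Matrix.of fun i j : Fin 2 => if i.val + j.val + 1 = 2 then (1 : L) else 0)).Local v ×
      (UnitaryGroup.cmDatum L 1 (Matrix.of fun i j : Fin 1 => if i.val + j.val + 1 = 1 then (1 : L) else 0)).Local v)}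
    {γ₀ : (UnitaryGroup.cmDatum L 2 (Matrix.of fun i j : Fin 2 => if i.val + j.val + 1 = 2 then (1 : L) else 0)).Local v ×
      (UnitaryGroup.cmDatum L 1 (Matrix.of fun i j : Fin 1 => if i.val + j.val + 1 = 1 then (1 : L) else 0)).Local v}
    (hγ₀ : IsLocalGRegular L v γ₀)
    (hT : T = Subgroup.centralizer ({γ₀} : Set ((UnitaryGroup.cmDatum L 2 (Matrix.of fun i j : Fin 2 => if i.val + j.val + 1 = 2 then (1 : L) else 0)).Local v ×
      (UnitaryGroup.cmDatum L 1 (Matrix.of fun i j : Fin 1 => if i.val + j.val + 1 = 1 then (1 : L) else 0)).Local v)))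
    (μT : Measure ↥T) [μT.IsHaarMeasure] (f : ↥T → E) :
    ∫ t in {t : ↥T | IsLocalGRegular L v (t : (UnitaryGroup.cmDatum L 2 (Matrix.of fun i j : Fin 2 => if i.val + j.val + 1 = 2 then (1 : L) else 0)).Local v ×
      (UnitaryGroup.cmDatum L 1 (Matrix.of fun i j : Fin 1 => if i.val + j.val + 1 = 1 then (1 : L) else 0)).Local v)}, f t ∂μT = ∫ t, f t ∂μT := by
  rw [restrict_setOf_isLocalGRegular_eq_self L v hns hγ₀ hT μT]

end CM

end Summit.HodgeConjecture.HodgeConjecture.Cruxes.H413.F0P3cStCharTSEllMassHNull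

end
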